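import Summits.CriticalPhenomena.SAWScalingLimit.Theorems.SAWLoopFugacityFlowAvoidanceLimitExcursionRatioSelf
import Literature.Probability.LatticeModels.MeshDomainJordan
import Literature.Probability.LatticeModels.MeshDomainBigComponents

/-!
# Lattice topology of a Jordan domain: interior points are approximated by joined lattice points
— stub `stub_latticeTopology` (S3b-TOP) of line `symplectic-fermion-anchor`
(crux `SAWLoopFugacityFlow.AvoidanceLimit`, stmt-CriticalPhenomena-10649)

The registered stub (TOP) of the assembly
`stub_sphereRatioLimit_of_oscillation_of_interiorLimit` (file `…SphereRatioLimitAssembly.lean`):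
for a Dobrushin domain `D`, two interior points `z*, y* ∈ D` and `s > 0`, for all small mesh `δ`
there are lattice points `u, v` with mesh points within `s` of `z*, y*` and
`0 < greenEntry (D_δ) (meshDomainFinset D δ) u v`, i.e. `u, v` are joined by a walk of the
discrete domain `D_δ = discreteDomainGraph D δ` inside the volume.

Proof: the closed balls `B̄(z*, ρ) ∪ B̄(y*, ρ)` (`ρ ≤ s/2`, inside the open `D`) form a compact
`K ⊆ D`; by the tree's `JordanDomain.exists_forall_mem_meshDomain_and_reachable`
(`MeshDomainJordan.lean`: the largest mesh component is the bulk) every lattice point with mesh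
point in `K` lies in `meshDomain D δ` for small `δ`, and any two points of `meshDomain D δ` are
joined in the mesh graph on mesh vertices; the nearest sites to `z*`, `y*` qualify
(`dist_meshPoint_nearestSite_le`), a joining walk stays in `meshDomain D δ`
(`mem_meshDomain_of_reachable_meshVertexGraph`) and is therefore a walk of `D_δ` inside the
volume, which makes the Green's function positive (`greenEntry_pos`).

Sources: folklore (lattice approximation of Jordan domains; Smirnov 2001 §2 "largest connected
component"). No definitions, no named facts.
-/

noncomputable section

open scoped BigOperators Topology
open Filter Finset
open Literature.Probability.RandomPlanarGeometry Literature.Probability.LatticeModels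

namespace Summit.CriticalPhenomena.SAWScalingLimit.Theorems.AvoidanceLimit.Anchor

/-- A walk of the mesh graph on mesh vertices starting in `meshDomain Ω δ` is (the image of) a
walk of the discrete domain `Ω_δ = discreteDomainGraph Ω δ` all of whose vertices lie in
`meshDomain Ω δ` (`Ω_δ` is a union of whole mesh components). [folklore] -/
theorem exists_walk_discreteDomainGraph_of_walk_meshVertexGraph {Ω : Set ℂ} {δ : ℝ}
    {x y : meshVertices Ω δ} (p : (meshVertexGraph Ω δ).Walk x y) (hx : x.1 ∈ meshDomain Ω δ) :
    ∃ q : (discreteDomainGraph Ω δ).Walk x.1 y.1, ∀ w ∈ q.support, w ∈ meshDomain Ω δ := by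
  induction p with
  | nil =>
      refine ⟨SimpleGraph.Walk.nil, fun w hw => ?_⟩
      rw [SimpleGraph.Walk.support_nil, List.mem_singleton] at hw
      exact hw ▸ hx
  | @cons a b c hab q ih =>
      have hb : b.1 ∈ meshDomain Ω δ :=
        mem_meshDomain_of_reachable_meshVertexGraph hx a.2 b.2 hab.reachable
      obtain ⟨q', hq'⟩ := ih hb
      have hadj : (discreteDomainGraph Ω δ).Adj a.1 b.1 :=
        discreteDomainGraph_adj_iff.2 ⟨hab, hx, hb⟩
      refine ⟨SimpleGraph.Walk.cons hadj q', fun w hw => ?_⟩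
      rw [SimpleGraph.Walk.support_cons, List.mem_cons] at hw
      rcases hw with rfl | hw
      · exact hx
      · exact hq' w hw

/-- **STUB S3b-TOP (registered) — lattice topology of a Jordan domain.** Two interior points
`z*, y* ∈ D` of a Dobrushin domain are, for all small `δ`, approximated within any `s > 0` by
lattice points `u, v` joined in `D_δ` inside the volume: `0 < greenEntry (D_δ) (meshDomainFinset D δ) u v`.
The largest mesh component swallows every compact part of `D` for small mesh
(`JordanDomain.exists_forall_mem_meshDomain_and_reachable`). [folklore] -/
theorem stub_latticeTopology :
    ∀ (D : DobrushinDomain) (zs ys : ℂ), zs ∈ D.carrier → ys ∈ D.carrier → ∀ s : ℝ, 0 < s →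
      ∀ᶠ δ in 𝓝[>] (0 : ℝ), ∃ u v : Site 2, dist (meshPoint δ u) zs < s ∧ dist (meshPoint δ v) ys < s ∧
        0 < greenEntry (discreteDomainGraph D.carrier δ) (meshDomainFinset D.carrier δ) u v := by
  intro D zs ys hzs hys s hs
  -- closed balls about the two points inside the open domain
  obtain ⟨ρ₁, hρ₁, hB₁⟩ := Metric.isOpen_iff.1 D.isOpen zs hzs
  obtain ⟨ρ₂, hρ₂, hB₂⟩ := Metric.isOpen_iff.1 D.isOpen ys hys
  set ρ : ℝ := min (min ρ₁ ρ₂) s / 2 with hρ_def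
  have hρ : 0 < ρ := by positivity
  have hρ1 : ρ < ρ₁ := by
    have : min (min ρ₁ ρ₂) s ≤ ρ₁ := (min_le_left _ _).trans (min_le_left _ _)
    simp only [hρ_def]; linarith
  have hρ2 : ρ < ρ₂ := by
    have : min (min ρ₁ ρ₂) s ≤ ρ₂ := (min_le_left _ _).trans (min_le_right _ _)
    simp only [hρ_def]; linarith
  have hρs : ρ < s := by
    have : min (min ρ₁ ρ₂) s ≤ s := min_le_right _ _
    simp only [hρ_def]; linarith
  set K : Set ℂ := Metric.closedBall zs ρ ∪ Metric.closedBall ys ρ with hK_def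
  have hKc : IsCompact K := (isCompact_closedBall _ _).union (isCompact_closedBall _ _)
  have hKD : K ⊆ D.carrier := by
    rintro w (hw | hw)
    · exact hB₁ (Metric.closedBall_subset_ball hρ1 hw)
    · exact hB₂ (Metric.closedBall_subset_ball hρ2 hw)
  obtain ⟨δ₀, hδ₀, hmesh⟩ :=
    JordanDomain.exists_forall_mem_meshDomain_and_reachable D.toJordanDomain hKc hKD
  have hδ : ∀ᶠ δ in 𝓝[>] (0 : ℝ), δ ∈ Set.Ioo (0 : ℝ) (min δ₀ ρ) := Ioo_mem_nhdsGT (lt_min hδ₀ hρ)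
  filter_upwards [hδ] with δ hδ'
  have hδpos : 0 < δ := hδ'.1
  have hδ0 : δ < δ₀ := lt_of_lt_of_le hδ'.2 (min_le_left _ _)
  have hδρ : δ < ρ := lt_of_lt_of_le hδ'.2 (min_le_right _ _)
  obtain ⟨hKmesh, hreach⟩ := hmesh δ hδpos hδ0
  -- the nearest sites
  set u : Site 2 := nearestSite δ zs with hu_def
  set v : Site 2 := nearestSite δ ys with hv_def
  have hu : dist (meshPoint δ u) zs ≤ δ := dist_meshPoint_nearestSite_le hδpos zs
  have hv : dist (meshPoint δ v) ys ≤ δ := dist_meshPoint_nearestSite_le hδpos ys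
  have huK : meshPoint δ u ∈ K := Or.inl (Metric.mem_closedBall.2 (by linarith))
  have hvK : meshPoint δ v ∈ K := Or.inr (Metric.mem_closedBall.2 (by linarith))
  have huD : u ∈ meshDomain D.carrier δ := hKmesh u huK
  have hvD : v ∈ meshDomain D.carrier δ := hKmesh v hvK
  obtain ⟨hux, hvx, hR⟩ := hreach u huD v hvD
  obtain ⟨p⟩ := hR
  obtain ⟨q, hq⟩ := exists_walk_discreteDomainGraph_of_walk_meshVertexGraph p huD
  refine ⟨u, v, by linarith, by linarith, ?_⟩
  refine greenEntry_pos ((discreteDomainGraph_le_meshGraph _ δ).trans (meshGraph_le_zdGraph _ δ)) q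
    fun w hw => ?_
  rw [← Finset.mem_coe, coe_meshDomainFinset D.isBounded hδpos]
  exact hq w hw

end Summit.CriticalPhenomena.SAWScalingLimit.Theorems.AvoidanceLimit.Anchor

end
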